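import Literature.MathematicalPhysics.KineticTheory.DiPernaLionsDampingLimit
import Literature.MathematicalPhysics.KineticTheory.DiPernaLionsApproxSupersolution
import Literature.MathematicalPhysics.KineticTheory.DiPernaLionsExpDuhamel
import HarnessLib

/-!
# The exponential form of the approximating sequence, tested and passed to the limit (CIP Step 13)

Topic: MathematicalPhysics / KineticTheory. Infrastructure for the named fact (L12)
`diPernaLions_limit_expDuhamel` (Cercignani–Illner–Pulvirenti 1994 §5.3 Lemma 5.3.12). Both halves
of the proof of Lemma 5.3.12 (pp. 158–159) start from the exponential form (3.36)
`fⁿ = f₀ⁿ e^{-Fₙ} + T_{Fₙ}⁻¹ Q̃₊ⁿ(fⁿ,fⁿ)` of the approximate solutions and pass to the limit in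
its three terms for a fixed time `t`, after testing against a bounded weight on phase space. This
file supplies the common bookkeeping, for a fixed `t ≥ 0` and a measurable set `S` of
characteristics `(x, v)`:

* `lintegral_set_damped_sharp_eq` (**free-flow coordinates**): an integral over `S` of a damped
  time integral along the characteristics, `∫_S ∫₀ᵗ D(s,x,v) G(s, x + sv, v) ds`, equals the
  phase-space-time integral of `G` against the sheared weight
  `1_{(0,t]}(s) 1_S(y - sv, v) D(s, y - sv, v)` (the shear `(s,x,v) ↦ (s, x+sv, v)` preserves
  Lebesgue measure; Tonelli).
* `IsDiPernaLionsApproximateSolution.lintegral_set_sharp_eq` (**(3.36) integrated over `S`**):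
  `∫_S fⁿ♯(t) = ∫_S fⁿ(0) e^{-Λₙ♯(t)} + ∫_S (T_{Λₙ}⁻¹ Q̃₊ⁿ)♯(t)` in `[0, ∞]`, with the true
  gain integral, and the finiteness of all three terms.
* `IsDiPernaLionsWeakLimit.tendsto_setIntegral_sharp_slice` (**the left-hand side**):
  `∫_S f^{φ(k)}♯(t) → ∫_S f♯(t)` (weak convergence of the slices, (3.35)-type invariance of the
  test weights under the shear).
* `IsDiPernaLionsWeakLimit.tendsto_setIntegral_initial_damped` (**the first term**, granted the
  velocity-averaging lemma through `Fₙ → F`, `DiPernaLionsDampingLimit`):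
  `∫_S f^{φ(k)}(0) e^{-Λ_{φ(k)}♯(t)} → ∫_S f₀ e^{-F♯(t)}`.
* `IsDiPernaLionsWeakLimit.tendsto_lintegral_damping_weight_sub` (**the damping weights**, granted
  the velocity-averaging lemma): `∫_{(0,t]×E×B̄_R} |e^{-(Λₖ♯(t)-Λₖ♯(s))} - e^{-(F♯(t)-F♯(s))}| → 0`
  along the characteristics, from `sup_{s ≤ T} ‖Λₖ♯(s) - F♯(s)‖_{L¹(E×B̄_R)} ≤ ‖λₖ - A∗f‖_{L¹}`.

Everything in this file is proved; theorems only; no named fact is introduced (the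
velocity-averaging lemma enters as the hypothesis `h9`, discharged downstream by
`velocityAverage_relativelyCompact_L1_holds`).

## References

* C. Cercignani, R. Illner, M. Pulvirenti, *The Mathematical Theory of Dilute Gases*, Springer
  (1994), §5.3 Step 13 ((3.35)–(3.36), p. 157) and proof of Lemma 5.3.12 (pp. 158–159).
* R. J. DiPerna, P.-L. Lions, *On the Cauchy problem for Boltzmann equations: global existence and
  weak stability*, Ann. of Math. 130 (1989) 321–366.
-/

open MeasureTheory Metric Real Set Filter Topology
open scoped InnerProductSpace ENNReal NNReal

noncomputable section

namespace Literature.MathematicalPhysics.KineticTheory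

open Literature.Analysis.FluidPDE Literature.Analysis.FunctionSpaces DiPernaLionsMildLimitProofs

section FreeFlow

variable {E : Type*} [NormedAddCommGroup E] [InnerProductSpace ℝ E] [FiniteDimensional ℝ E]
  [MeasurableSpace E] [BorelSpace E]

/-- **Free-flow coordinates for damped time integrals along characteristics**: for measurable
`G ≥ 0` on phase space-time, a measurable weight `D(s, (x,v)) ≥ 0`, a measurable set `S` of
characteristics and `t ∈ ℝ`,
`∫_S ∫_{(0,t]} D(s,z) G(s, x + s v, v) ds d(x,v) = ∫ 1_{(0,t]}(s) 1_S(y - sv, v) D(s,(y - sv, v)) G(s,y,v)`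
(the shear `(s, x, v) ↦ (s, x + sv, v)` preserves Lebesgue measure; Tonelli). [folklore] -/
theorem lintegral_set_damped_sharp_eq {G : ℝ × E × E → ℝ≥0∞} (hG : Measurable G)
    {D : ℝ × (E × E) → ℝ≥0∞} (hD : Measurable D) {S : Set (E × E)} (hS : MeasurableSet S) (t : ℝ) :
    ∫⁻ z in S, (∫⁻ s in Ioc 0 t, D (s, z) * G (s, z.1 + s • z.2, z.2)) ∂((volume : Measure E).prod volume) =
      ∫⁻ q : ℝ × E × E, (Ioc 0 t).indicator (fun _ => (1 : ℝ≥0∞)) q.1 *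
        S.indicator (fun _ => (1 : ℝ≥0∞)) (q.2.1 - q.1 • q.2.2, q.2.2) *
        D (q.1, (q.2.1 - q.1 • q.2.2, q.2.2)) * G q := by
  -- the integrand in free-flow coordinates
  set F : ℝ × E × E → ℝ≥0∞ := fun q => (Ioc 0 t).indicator (fun _ => (1 : ℝ≥0∞)) q.1 *
    S.indicator (fun _ => (1 : ℝ≥0∞)) (q.2.1 - q.1 • q.2.2, q.2.2) *
    D (q.1, (q.2.1 - q.1 • q.2.2, q.2.2)) * G q with hF
  have hback : Measurable fun q : ℝ × E × E => ((q.2.1 - q.1 • q.2.2, q.2.2) : E × E) :=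
    (measurable_snd.fst.sub (measurable_fst.smul measurable_snd.snd)).prodMk measurable_snd.snd
  have hFm : Measurable F :=
    ((((measurable_const.indicator measurableSet_Ioc).comp measurable_fst).mul
      ((measurable_const.indicator hS).comp hback)).mul (hD.comp (measurable_fst.prodMk hback))).mul hG
  -- `F ∘ shearFlow`
  have hcomp : ∀ p : ℝ × E × E, F (shearFlow p) = (Ioc 0 t).indicator (fun _ => (1 : ℝ≥0∞)) p.1 *
      S.indicator (fun _ => (1 : ℝ≥0∞)) p.2 * D (p.1, p.2) * G (p.1, p.2.1 + p.1 • p.2.2, p.2.2) := by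
    intro p
    simp only [hF, shearFlow_apply, add_sub_cancel_right]
  have hmp := (measurePreserving_shearFlow (E := E)).lintegral_comp hFm
  change ∫⁻ p, F (shearFlow p) ∂(volume : Measure (ℝ × E × E)) = ∫⁻ q, F q ∂volume at hmp
  rw [← hmp]
  simp_rw [hcomp]
  -- Tonelli on `ℝ × (E × E)`
  have hH : Measurable fun p : ℝ × E × E => (Ioc 0 t).indicator (fun _ => (1 : ℝ≥0∞)) p.1 *
      S.indicator (fun _ => (1 : ℝ≥0∞)) p.2 * D (p.1, p.2) * G (p.1, p.2.1 + p.1 • p.2.2, p.2.2) :=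
    ((((measurable_const.indicator measurableSet_Ioc).comp measurable_fst).mul
      ((measurable_const.indicator hS).comp measurable_snd)).mul hD).mul
      (hG.comp measurableEmbedding_shearFlow.measurable)
  rw [show (volume : Measure (ℝ × E × E)) = (volume : Measure ℝ).prod ((volume : Measure E).prod volume)
    from rfl, lintegral_prod_symm _ hH.aemeasurable]
  -- identify the set integrals
  rw [← lintegral_indicator hS]
  refine lintegral_congr fun z => ?_
  by_cases hz : z ∈ S
  · rw [indicator_of_mem hz, ← lintegral_indicator measurableSet_Ioc]
    refine lintegral_congr fun s => ?_
    by_cases hs : s ∈ Ioc 0 t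
    · simp only [indicator_of_mem hs, indicator_of_mem hz, one_mul]
    · simp only [indicator_of_notMem hs, zero_mul]
  · rw [indicator_of_notMem hz]
    simp only [indicator_of_notMem hz, mul_zero, zero_mul, lintegral_const, zero_mul]

/-- The damped gain primitive of a density `f` integrated over a measurable set of
characteristics, in free-flow coordinates:
`∫_S (T_F⁻¹ Q₊(f,f))♯(t) = ∫ 1_{(0,t]}(s) 1_S(y - sv, v) e^{-(F♯(t,y-sv,v) - F♯(s,y-sv,v))} Q₊(f,f)(s,y,v)`
(`eDampedGainPrimitive`, true gain integral). [cite: CIPDiluteGases1994, §5.3 Step 13 (p. 157)] -/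
theorem lintegral_set_eDampedGainPrimitive_eq {B : E × E → sphere (0 : E) 1 → ℝ}
    (hBm : Measurable (Function.uncurry B)) {f : ℝ → E → E → ℝ}
    (hfm : Measurable fun z : ℝ × E × E => f z.1 z.2.1 z.2.2) {S : Set (E × E)}
    (hS : MeasurableSet S) (t : ℝ) :
    ∫⁻ z in S, eDampedGainPrimitive B f t z.1 z.2 ∂((volume : Measure E).prod volume) =
      ∫⁻ q : ℝ × E × E, (Ioc 0 t).indicator (fun _ => (1 : ℝ≥0∞)) q.1 *
        S.indicator (fun _ => (1 : ℝ≥0∞)) (q.2.1 - q.1 • q.2.2, q.2.2) *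
        ENNReal.ofReal (exp (-(dampingExponent B f t (q.2.1 - q.1 • q.2.2) q.2.2 -
          dampingExponent B f q.1 (q.2.1 - q.1 • q.2.2) q.2.2))) * eGain B f q := by
  have hD : Measurable fun p : ℝ × (E × E) => ENNReal.ofReal (exp (-(dampingExponent B f t p.2.1 p.2.2 -
      dampingExponent B f p.1 p.2.1 p.2.2))) := by
    have h1 : Measurable fun p : ℝ × (E × E) => dampingExponent B f t p.2.1 p.2.2 :=
      (measurable_dampingExponent hBm hfm).comp (measurable_const.prodMk measurable_snd)
    have h2 : Measurable fun p : ℝ × (E × E) => dampingExponent B f p.1 p.2.1 p.2.2 :=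
      measurable_dampingExponent hBm hfm
    exact (h1.sub h2).neg.exp.ennreal_ofReal
  rw [← lintegral_set_damped_sharp_eq (measurable_eGain hBm hfm) hD hS t]
  refine lintegral_congr fun z => ?_
  rw [eDampedGainPrimitive_apply]
  refine lintegral_congr fun s => ?_
  rw [mul_comm]

end FreeFlow

section Approx

variable {E : Type*} [NormedAddCommGroup E] [InnerProductSpace ℝ E] [FiniteDimensional ℝ E]
  [MeasurableSpace E] [BorelSpace E]

variable {δ' : ℝ} {B' : E × E → sphere (0 : E) 1 → ℝ} {g : ℝ → E → E → ℝ}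

/-- Joint measurability in `(s, (x, v))` of the (time-clamped) damping weight
`a♯(s ∨ 0) e^{-(Λ♯(t) - Λ♯(s))}` of an approximate solution. [folklore] -/
theorem IsDiPernaLionsApproximateSolution.measurable_dampingWeight
    (hg : IsDiPernaLionsApproximateSolution δ' B' g) (hB'm : Measurable (Function.uncurry B')) (t : ℝ) :
    Measurable fun p : ℝ × (E × E) =>
      ENNReal.ofReal ((1 + δ' * ∫ w, |g (max p.1 0) (p.2.1 + p.1 • p.2.2) w|)⁻¹) *
      ENNReal.ofReal (exp (-(truncatedDampingExponent δ' B' g t p.2.1 p.2.2 -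
        truncatedDampingExponent δ' B' g p.1 p.2.1 p.2.2))) := by
  have hΛ := hg.measurable_truncatedDampingExponent hB'm
  have h1 : Measurable fun p : ℝ × (E × E) => truncatedDampingExponent δ' B' g t p.2.1 p.2.2 :=
    hΛ.comp (measurable_const.prodMk measurable_snd)
  have h2 : Measurable fun p : ℝ × (E × E) => truncatedDampingExponent δ' B' g p.1 p.2.1 p.2.2 := hΛ
  have h3 : Measurable fun p : ℝ × (E × E) => ∫ w, |g (max p.1 0) (p.2.1 + p.1 • p.2.2) w| :=
    hg.measurable_velocityMass_clamp.comp (measurable_fst.prodMk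
      ((measurable_snd.fst.add (measurable_fst.smul measurable_snd.snd)).prodMk measurable_snd.snd))
  exact ((measurable_const.add (measurable_const.mul h3)).inv.ennreal_ofReal).mul
    (h1.sub h2).neg.exp.ennreal_ofReal

/-- **(3.36) integrated over a set of characteristics** (CIP 1994 §5.3 Step 13, p. 157): for an
approximate solution `g` with a bounded DiPerna–Lions kernel vanishing for large relative
velocities, `δ ≥ 0`, `t ≥ 0` and a measurable `S ⊆ E × E`,
`∫_S g♯(t) = ∫_S g(0) e^{-Λ♯(t)} + ∫_S ∫₀ᵗ a♯ Q₊(g,g)♯ e^{-(Λ♯(t)-Λ♯(s))} ds` in `[0, ∞]`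
(`ofReal_sharp_eq_lintegral` integrated). [cite: CIPDiluteGases1994, §5.3 Step 13 (3.36) (p. 157)] -/
theorem IsDiPernaLionsApproximateSolution.lintegral_set_sharp_eq
    (hg : IsDiPernaLionsApproximateSolution δ' B' g) (hB'k : IsDiPernaLionsKernel B') {Cb : ℝ}
    (hCb : ∀ p ω, B' p ω ≤ Cb) {Rb : ℝ} (hRb : ∀ (z : E) ω, Rb ≤ ‖z‖ → B' (z, 0) ω = 0)
    (hδ' : 0 ≤ δ') (t : ℝ) (ht : 0 ≤ t) (S : Set (E × E)) :
    ∫⁻ z in S, ENNReal.ofReal (g t (z.1 + t • z.2) z.2) ∂((volume : Measure E).prod volume) =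
      (∫⁻ z in S, ENNReal.ofReal (g 0 z.1 z.2 * exp (-(truncatedDampingExponent δ' B' g t z.1 z.2)))
        ∂((volume : Measure E).prod volume)) +
      ∫⁻ z in S, (∫⁻ s in Ioc 0 t, ENNReal.ofReal ((1 + δ' * ∫ w, |g s (z.1 + s • z.2) w|)⁻¹) *
          eGain B' g (s, z.1 + s • z.2, z.2) *
          ENNReal.ofReal (exp (-(truncatedDampingExponent δ' B' g t z.1 z.2 -
            truncatedDampingExponent δ' B' g s z.1 z.2)))) ∂((volume : Measure E).prod volume) := by
  have hm : Measurable fun z : E × E => ENNReal.ofReal (g 0 z.1 z.2 *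
      exp (-(truncatedDampingExponent δ' B' g t z.1 z.2))) := by
    have h1 : Measurable fun z : E × E => truncatedDampingExponent δ' B' g t z.1 z.2 :=
      (hg.measurable_truncatedDampingExponent hB'k.measurable).comp (measurable_const.prodMk measurable_id)
    have h2 : Measurable fun z : E × E => g 0 z.1 z.2 :=
      (hg.contDiff_slice 0 le_rfl).continuous.measurable
    exact (h2.mul h1.neg.exp).ennreal_ofReal
  rw [← lintegral_add_left hm]
  refine lintegral_congr fun z => ?_
  exact hg.ofReal_sharp_eq_lintegral hB'k hCb hRb hδ' t ht z.1 z.2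

/-- The three terms of (3.36) integrated over a set of characteristics are finite (the slices of an
approximate solution are integrable, sheared or not). [folklore] -/
theorem IsDiPernaLionsApproximateSolution.lintegral_set_sharp_lt_top
    (hg : IsDiPernaLionsApproximateSolution δ' B' g) (t : ℝ) (ht : 0 ≤ t) (S : Set (E × E)) :
    ∫⁻ z in S, ENNReal.ofReal (g t (z.1 + t • z.2) z.2) ∂((volume : Measure E).prod volume) < ∞ := by
  have hi := (hg.integrable_slice t ht)
  have hsh : Integrable (fun z : E × E => g t (z.1 + t • z.2) z.2) ((volume : Measure E).prod volume) :=
    (measurePreserving_freeShear (E := E) t).integrable_comp hi.aestronglyMeasurable |>.2 hi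
  calc ∫⁻ z in S, ENNReal.ofReal (g t (z.1 + t • z.2) z.2) ∂((volume : Measure E).prod volume)
      ≤ ∫⁻ z, ENNReal.ofReal (g t (z.1 + t • z.2) z.2) ∂((volume : Measure E).prod volume) :=
        lintegral_mono' Measure.restrict_le_self le_rfl
    _ ≤ ∫⁻ z, ‖g t (z.1 + t • z.2) z.2‖ₑ ∂((volume : Measure E).prod volume) :=
        lintegral_mono fun z => Real.ofReal_le_enorm _
    _ < ∞ := hsh.2

end Approx

section Limits

universe u

variable {E : Type u} [NormedAddCommGroup E] [InnerProductSpace ℝ E] [FiniteDimensional ℝ E]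
  [MeasurableSpace E] [BorelSpace E]

variable {B : E × E → sphere (0 : E) 1 → ℝ} {f₀ : E → E → ℝ} {δ : ℕ → ℝ}
  {Bseq : ℕ → E × E → sphere (0 : E) 1 → ℝ} {fseq : ℕ → ℝ → E → E → ℝ} {φ : ℕ → ℕ}
  {f : ℝ → E → E → ℝ}

/-- **The left-hand side of (3.36) in the limit**: `∫_S f^{φ(k)}♯(t) → ∫_S f♯(t)` for every
measurable set `S` of characteristics (weak convergence of the slices composed with the
measure-preserving shear, CIP 1994 §5.3 Step 10 and Step 13). [cite: CIPDiluteGases1994, §5.3 Step 13 (p. 157)] -/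
theorem IsDiPernaLionsWeakLimit.tendsto_setIntegral_sharp_slice (hW : IsDiPernaLionsWeakLimit f₀ fseq φ f)
    {t : ℝ} (ht : 0 ≤ t) {S : Set (E × E)} (hS : MeasurableSet S) :
    Tendsto (fun k => ∫ z in S, fseq (φ k) t (z.1 + t • z.2) z.2 ∂((volume : Measure E).prod volume))
      atTop (𝓝 (∫ z in S, f t (z.1 + t • z.2) z.2 ∂((volume : Measure E).prod volume))) := by
  have h := (hW.tendstoWeaklyL1_slice t ht).comp_measurePreserving (freeShearEquiv (E := E) t)
    (measurePreserving_freeShearEquiv t)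
  simp only [freeShearEquiv_apply] at h
  exact h.tendsto_setIntegral hS

/-- The elementary inequality behind the stability of the damping factors:
`|e^{-x} - (1 ∧ e^{-y})| ≤ |x - y|` for `x ≥ 0` (`1 ∧ e^{-y} = e^{-(y ∨ 0)}` and `e^{-·}` is
`1`-Lipschitz on `[0, ∞)`). [folklore] -/
theorem abs_exp_neg_sub_min_le {x y : ℝ} (hx : 0 ≤ x) : |exp (-x) - min 1 (exp (-y))| ≤ |x - y| := by
  have hmin : min 1 (exp (-y)) = exp (-(max y 0)) := by
    rcases le_total y 0 with h | h
    · rw [max_eq_right h, neg_zero, exp_zero, min_eq_left (one_le_exp (by linarith))]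
    · rw [max_eq_left h, min_eq_right (exp_le_one_iff.2 (by linarith))]
  rw [hmin]
  have h1 : |exp (-x) - exp (-(max y 0))| ≤ |x - max y 0| := by
    -- mean value / convexity: on `[0, ∞)`, `|e^{-a} - e^{-b}| ≤ |a - b|`
    have key : ∀ a b : ℝ, 0 ≤ a → a ≤ b → exp (-b) ≥ exp (-a) - (b - a) := by
      intro a b ha hab
      have := Real.add_one_le_exp (-(b - a))
      have hea : exp (-a) ≤ 1 := exp_le_one_iff.2 (by linarith)
      calc exp (-b) = exp (-a) * exp (-(b - a)) := by rw [← Real.exp_add]; ring_nf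
        _ ≥ exp (-a) * (-(b - a) + 1) := mul_le_mul_of_nonneg_left this (exp_pos _).le
        _ ≥ exp (-a) - (b - a) := by nlinarith [exp_pos (-a)]
    have hmy : 0 ≤ max y 0 := le_max_right _ _
    rcases le_total x (max y 0) with h | h
    · have := key x (max y 0) hx h
      have h2 : exp (-(max y 0)) ≤ exp (-x) := exp_le_exp.2 (by linarith)
      rw [abs_of_nonneg (by linarith), abs_of_nonpos (by linarith)]
      linarith
    · have := key (max y 0) x hmy h
      have h2 : exp (-x) ≤ exp (-(max y 0)) := exp_le_exp.2 (by linarith)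
      rw [abs_of_nonpos (by linarith), abs_of_nonneg (by linarith)]
      linarith
  refine h1.trans ?_
  rcases le_total y 0 with h | h
  · rw [max_eq_right h]
    rw [abs_of_nonneg (by linarith : (0 : ℝ) ≤ x - 0)]
    have : x - 0 ≤ x - y := by linarith
    exact this.trans (le_abs_self _)
  · rw [max_eq_left h]

/-- A Borel, nonnegative, integrable representative of DiPerna–Lions data. [folklore] -/
theorem exists_measurable_nonneg_rep_of_data (hf₀ : HasDiPernaLionsData f₀) :
    ∃ F : E × E → ℝ, Measurable F ∧ (∀ z, 0 ≤ F z) ∧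
      (fun z : E × E => f₀ z.1 z.2) =ᵐ[(volume : Measure E).prod volume] F ∧
      Integrable F ((volume : Measure E).prod volume) := by
  have hae := hf₀.aestronglyMeasurable
  have hint : Integrable (fun z : E × E => f₀ z.1 z.2) ((volume : Measure E).prod volume) := by
    refine hf₀.2.mono hae (ae_of_all _ fun z => ?_)
    rw [Real.norm_eq_abs, Real.norm_eq_abs, abs_of_nonneg (hf₀.1 _ _),
      abs_of_nonneg (mul_nonneg (hf₀.1 _ _) (by positivity))]
    refine le_mul_of_one_le_right (hf₀.1 _ _) ?_
    nlinarith [sq_nonneg ‖z.1‖, sq_nonneg ‖z.2‖, abs_nonneg (log (f₀ z.1 z.2))]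
  refine ⟨fun z => max (hae.mk _ z) 0, hae.stronglyMeasurable_mk.measurable.max measurable_const,
    fun z => le_max_right _ _, ?_, ?_⟩
  · filter_upwards [hae.ae_eq_mk] with z hz
    rw [← hz, max_eq_left (hf₀.1 _ _)]
  · refine hint.congr ?_
    filter_upwards [hae.ae_eq_mk] with z hz
    rw [← hz, max_eq_left (hf₀.1 _ _)]

/-- **The first term of (3.36) in the limit** (CIP 1994 §5.3 Step 13, "for all `t ∈ ℝ₊`,
`Fₙ → F` a.e.", granted the velocity-averaging lemma through `DiPernaLionsDampingLimit`, and
`f₀ⁿ → f₀` in `L¹`): for `t ∈ [0,T]` and every measurable set `S` of characteristics,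
`∫_S f^{φ(k)}(0) e^{-Λ_{φ(k)}♯(t)} → ∫_S f₀ e^{-F♯(t)}`. [cite: CIPDiluteGases1994, §5.3 Step 13 (3.35)–(3.36) (p. 157)] -/
theorem IsDiPernaLionsWeakLimit.tendsto_setIntegral_initial_damped
    (hW : IsDiPernaLionsWeakLimit f₀ fseq φ f) (h9 : velocityAverage_relativelyCompact_L1.{u})
    (hB : IsDiPernaLionsKernel B) (hf₀ : HasDiPernaLionsData f₀) (hδ : ∀ n, 0 < δ n)
    (hanti : Antitone δ) (hlim : Tendsto δ atTop (𝓝 0)) (hker : IsDiPernaLionsKernelApproximation B Bseq)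
    (hdata : IsDiPernaLionsDataApproximation f₀ (fun n => fseq n 0))
    (hsol : ∀ n, IsDiPernaLionsApproximateSolution (δ n) (Bseq n) (fseq n))
    (hbd : UniformDiPernaLionsBounds δ Bseq fseq) {T t : ℝ} (ht : t ∈ Icc 0 T) (S : Set (E × E)) :
    Tendsto (fun k => ∫ z in S, fseq (φ k) 0 z.1 z.2 *
        exp (-(truncatedDampingExponent (δ (φ k)) (Bseq (φ k)) (fseq (φ k)) t z.1 z.2))
        ∂((volume : Measure E).prod volume)) atTop
      (𝓝 (∫ z in S, f₀ z.1 z.2 * exp (-(dampingExponent B f t z.1 z.2)) ∂((volume : Measure E).prod volume))) := by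
  set μ : Measure (E × E) := (volume : Measure E).prod volume with hμ
  -- a Borel representative of the data
  obtain ⟨a₀, ha₀m, ha₀0, ha₀ae, ha₀i⟩ := exists_measurable_nonneg_rep_of_data hf₀
  -- notation
  set a : ℕ → E × E → ℝ := fun k z => fseq (φ k) 0 z.1 z.2 with ha
  set Λk : ℕ → E × E → ℝ := fun k z =>
    truncatedDampingExponent (δ (φ k)) (Bseq (φ k)) (fseq (φ k)) t z.1 z.2 with hΛk
  set Λ : E × E → ℝ := fun z => dampingExponent B f t z.1 z.2 with hΛ
  -- basic properties
  have ha0 : ∀ k z, 0 ≤ a k z := fun k z => (hsol (φ k)).nonneg 0 le_rfl _ _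
  have hΛk0 : ∀ k z, 0 ≤ Λk k z := fun k z =>
    truncatedDampingExponent_nonneg (hker.isDiPernaLionsKernel (φ k)).nonneg (hδ (φ k)).le
      (hsol (φ k)).nonneg t z.1 z.2
  have hΛ0 : ∀ z, 0 ≤ Λ z := fun z => by
    simp only [hΛ, dampingExponent, freePrimitive]
    exact setIntegral_nonneg measurableSet_Ioc fun s hs =>
      DiPernaLionsMildLimitProofs.collisionFrequency_nonneg hB.nonneg
        (fun w => hW.nonneg s hs.1.le _ _) _
  have hai : ∀ k, Integrable (a k) μ := fun k => (hsol (φ k)).integrable_slice 0 le_rfl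
  have ham : ∀ k, Measurable (a k) := fun k =>
    ((hsol (φ k)).contDiff_slice 0 le_rfl).continuous.measurable
  have hΛkm : ∀ k, Measurable (Λk k) := fun k =>
    ((hsol (φ k)).measurable_truncatedDampingExponent (hker.isDiPernaLionsKernel (φ k)).measurable).comp
      (measurable_const.prodMk measurable_id)
  have hΛm : Measurable Λ := (measurable_dampingExponent hB.measurable hW.measurable).comp
    (measurable_const.prodMk measurable_id)
  have hukm : ∀ k, Measurable fun z => exp (-(Λk k z)) := fun k => (hΛkm k).neg.exp
  have hum : Measurable fun z => exp (-(Λ z)) := hΛm.neg.exp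
  have huk1 : ∀ k z, exp (-(Λk k z)) ≤ 1 := fun k z => exp_le_one_iff.2 (by linarith [hΛk0 k z])
  have hu1 : ∀ z, exp (-(Λ z)) ≤ 1 := fun z => exp_le_one_iff.2 (by linarith [hΛ0 z])
  have hD1 : ∀ k z, |exp (-(Λk k z)) - exp (-(Λ z))| ≤ 1 := fun k z => by
    have h1 := exp_pos (-(Λk k z)); have h2 := exp_pos (-(Λ z))
    rw [abs_le]; constructor <;> linarith [huk1 k z, hu1 z]
  have hDle : ∀ k z, |exp (-(Λk k z)) - exp (-(Λ z))| ≤ |Λk k z - Λ z| := fun k z => by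
    have h := abs_exp_neg_sub_min_le (y := Λ z) (hΛk0 k z)
    rwa [min_eq_right (hu1 z)] at h
  -- integrability of the products
  have hPk : ∀ k, Integrable (fun z => a k z * exp (-(Λk k z))) μ := fun k =>
    (hai k).mul_bdd (hukm k).aestronglyMeasurable (ae_of_all _ fun z => by
      rw [Real.norm_eq_abs, abs_of_pos (exp_pos _)]; exact huk1 k z)
  have hP : Integrable (fun z => a₀ z * exp (-(Λ z))) μ :=
    ha₀i.mul_bdd hum.aestronglyMeasurable (ae_of_all _ fun z => by
      rw [Real.norm_eq_abs, abs_of_pos (exp_pos _)]; exact hu1 z)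
  have hdiffi : ∀ k, Integrable (fun z => |a k z - a₀ z|) μ := fun k => ((hai k).sub ha₀i).abs
  have hDi : ∀ k, Integrable (fun z => a₀ z * |exp (-(Λk k z)) - exp (-(Λ z))|) μ := fun k =>
    ha₀i.mul_bdd ((hukm k).sub hum).abs.aestronglyMeasurable (ae_of_all _ fun z => by
      rw [Real.norm_eq_abs, abs_abs]; exact hD1 k z)
  -- replace `f₀` by its representative in the limit
  have hlimit_eq : ∫ z in S, f₀ z.1 z.2 * exp (-(dampingExponent B f t z.1 z.2)) ∂μ =
      ∫ z in S, a₀ z * exp (-(Λ z)) ∂μ := by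
    refine integral_congr_ae (ae_restrict_of_ae ?_)
    filter_upwards [ha₀ae] with z hz
    simp only [hΛ]; rw [hz]
  rw [hlimit_eq]
  -- reduce to `∫ |difference| → 0` on the whole space
  rw [tendsto_iff_norm_sub_tendsto_zero]
  have hbound : ∀ k, ‖(∫ z in S, a k z * exp (-(Λk k z)) ∂μ) - ∫ z in S, a₀ z * exp (-(Λ z)) ∂μ‖ ≤
      (∫ z, |a k z - a₀ z| ∂μ) + ∫ z, a₀ z * |exp (-(Λk k z)) - exp (-(Λ z))| ∂μ := by
    intro k
    rw [← integral_sub (hPk k).integrableOn hP.integrableOn]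
    calc ‖∫ z in S, (a k z * exp (-(Λk k z)) - a₀ z * exp (-(Λ z))) ∂μ‖
        ≤ ∫ z in S, ‖a k z * exp (-(Λk k z)) - a₀ z * exp (-(Λ z))‖ ∂μ := norm_integral_le_integral_norm _
      _ ≤ ∫ z, ‖a k z * exp (-(Λk k z)) - a₀ z * exp (-(Λ z))‖ ∂μ :=
          setIntegral_le_integral ((hPk k).sub hP).norm (ae_of_all _ fun z => norm_nonneg _)
      _ ≤ ∫ z, (|a k z - a₀ z| + a₀ z * |exp (-(Λk k z)) - exp (-(Λ z))|) ∂μ := by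
          refine integral_mono ((hPk k).sub hP).norm ((hdiffi k).add (hDi k)) fun z => ?_
          rw [Real.norm_eq_abs]
          have : a k z * exp (-(Λk k z)) - a₀ z * exp (-(Λ z)) =
              (a k z - a₀ z) * exp (-(Λk k z)) + a₀ z * (exp (-(Λk k z)) - exp (-(Λ z))) := by ring
          rw [this]
          refine (abs_add_le _ _).trans ?_
          rw [abs_mul, abs_mul, abs_of_nonneg (ha₀0 z), abs_of_pos (exp_pos _)]
          have h1 : |a k z - a₀ z| * exp (-(Λk k z)) ≤ |a k z - a₀ z| :=
            mul_le_of_le_one_right (abs_nonneg _) (huk1 k z)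
          linarith
      _ = (∫ z, |a k z - a₀ z| ∂μ) + ∫ z, a₀ z * |exp (-(Λk k z)) - exp (-(Λ z))| ∂μ :=
          integral_add (hdiffi k) (hDi k)
  refine squeeze_zero (fun k => norm_nonneg _) hbound ?_
  rw [← add_zero (0 : ℝ)]
  refine Tendsto.add ?_ ?_
  · -- `‖f₀ⁿ - f₀‖₁ → 0`
    have hL1 := hdata.tendsto_lintegral_sub.comp hW.strictMono.tendsto_atTop
    have heq : ∀ k, ∫ z, |a k z - a₀ z| ∂μ =
        (∫⁻ z : E × E, ‖fseq (φ k) 0 z.1 z.2 - f₀ z.1 z.2‖ₑ ∂μ).toReal := by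
      intro k
      rw [integral_eq_lintegral_of_nonneg_ae (f := fun z => |a k z - a₀ z|) (ae_of_all _ fun z => abs_nonneg _)
        (((ham k).sub ha₀m).abs).aestronglyMeasurable]
      congr 1
      refine lintegral_congr_ae ?_
      filter_upwards [ha₀ae] with z hz
      rw [← Real.enorm_eq_ofReal_abs, ← hz]
    simp only [heq]
    rw [← ENNReal.toReal_zero]
    exact (ENNReal.tendsto_toReal ENNReal.zero_ne_top).comp hL1
  · -- `∫ a₀ |e^{-Λₖ} - e^{-Λ}| → 0`: split off large velocities and large values of `a₀`
    rw [Metric.tendsto_atTop]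
    intro ε hε
    -- tightness in `v`: `∫_{|v| > R} a₀ ≤ ε/4`
    have htight : ∃ R : ℕ, ∫ z in ((univ : Set E) ×ˢ closedBall (0 : E) R)ᶜ, a₀ z ∂μ < ε / 4 := by
      have h := tendsto_setIntegral_of_antitone (μ := μ) (f := a₀)
        (s := fun R : ℕ => ((univ : Set E) ×ˢ closedBall (0 : E) R)ᶜ)
        (fun R => (MeasurableSet.univ.prod measurableSet_closedBall).compl)
        (fun R R' h => compl_subset_compl.2 (prod_mono subset_rfl
          (closedBall_subset_closedBall (by exact_mod_cast h)))) ⟨0, ha₀i.integrableOn⟩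
      have hempty : (⋂ R : ℕ, ((univ : Set E) ×ˢ closedBall (0 : E) R)ᶜ) = ∅ := by
        ext z
        simp only [mem_iInter, mem_compl_iff, mem_prod, mem_univ, true_and, mem_closedBall_zero_iff,
          not_le, mem_empty_iff_false, iff_false, not_forall, not_lt]
        exact exists_nat_ge ‖z.2‖
      rw [hempty, Measure.restrict_empty, integral_zero_measure] at h
      rw [Metric.tendsto_atTop] at h
      obtain ⟨R, hR⟩ := h (ε / 4) (by positivity)
      refine ⟨R, ?_⟩
      have := hR R le_rfl
      rw [Real.dist_eq, sub_zero] at this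
      exact lt_of_le_of_lt (le_abs_self _) this
    obtain ⟨R, hR⟩ := htight
    -- large values of `a₀`: `∫_{a₀ > N} a₀ ≤ ε/4`
    have hlarge : ∃ N : ℕ, ∫ z in {z | (N : ℝ) + 1 < a₀ z}, a₀ z ∂μ < ε / 4 := by
      have h := tendsto_setIntegral_of_antitone (μ := μ) (f := a₀)
        (s := fun N : ℕ => {z | (N : ℝ) + 1 < a₀ z})
        (fun N => measurableSet_lt measurable_const ha₀m)
        (fun N N' h z hz => by
          simp only [mem_setOf_eq] at hz ⊢
          have hc : (N : ℝ) ≤ (N' : ℝ) := by exact_mod_cast h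
          have h' : (N : ℝ) + 1 ≤ (N' : ℝ) + 1 := by linarith
          exact lt_of_le_of_lt h' hz)
        ⟨0, ha₀i.integrableOn⟩
      have hempty : (⋂ N : ℕ, {z : E × E | (N : ℝ) + 1 < a₀ z}) = ∅ := by
        ext z
        simp only [mem_iInter, mem_setOf_eq, mem_empty_iff_false, iff_false, not_forall, not_lt]
        obtain ⟨N, hN⟩ := exists_nat_ge (a₀ z); exact ⟨N, by linarith⟩
      rw [hempty, Measure.restrict_empty, integral_zero_measure] at h
      rw [Metric.tendsto_atTop] at h
      obtain ⟨N, hN⟩ := h (ε / 4) (by positivity)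
      refine ⟨N, ?_⟩
      have := hN N le_rfl
      rw [Real.dist_eq, sub_zero] at this
      exact lt_of_le_of_lt (le_abs_self _) this
    obtain ⟨N, hN⟩ := hlarge
    set N' : ℝ := (N : ℝ) + 1 with hN'
    have hN'0 : 0 < N' := by positivity
    -- the damping exponents converge in `L¹(E × B̄_R)`
    have hdamp := tendsto_lintegral_enorm_truncatedDampingExponent_sub h9 hB hf₀ hδ hanti hlim hker hdata
      hsol hbd hW ht R
    rw [ENNReal.tendsto_atTop_zero] at hdamp
    obtain ⟨K₀, hK₀⟩ := hdamp (ENNReal.ofReal (ε / (4 * N'))) (by simpa using by positivity)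
    refine ⟨K₀, fun k hk => ?_⟩
    rw [Real.dist_eq, sub_zero, abs_of_nonneg (integral_nonneg fun z => mul_nonneg (ha₀0 z) (abs_nonneg _))]
    -- pointwise bound: `a₀ |Δ| ≤ a₀ 1_{|v|>R} + a₀ 1_{a₀ > N'} + N' 1_{|v| ≤ R} |Λₖ - Λ|`
    set SR : Set (E × E) := (univ : Set E) ×ˢ closedBall (0 : E) R with hSR
    have hSRm : MeasurableSet SR := MeasurableSet.univ.prod measurableSet_closedBall
    set SN : Set (E × E) := {z | N' < a₀ z} with hSN
    have hSNm : MeasurableSet SN := measurableSet_lt measurable_const ha₀m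
    have hpt : ∀ z, a₀ z * |exp (-(Λk k z)) - exp (-(Λ z))| ≤ SRᶜ.indicator a₀ z + SN.indicator a₀ z +
        N' * SR.indicator (fun z => |Λk k z - Λ z|) z := by
      intro z
      have hle1 : a₀ z * |exp (-(Λk k z)) - exp (-(Λ z))| ≤ a₀ z :=
        mul_le_of_le_one_right (ha₀0 z) (hD1 k z)
      by_cases hzR : z ∈ SR
      · rw [indicator_of_notMem (notMem_compl_iff.2 hzR), indicator_of_mem hzR, zero_add]
        by_cases hzN : z ∈ SN
        · rw [indicator_of_mem hzN]
          nlinarith [abs_nonneg (Λk k z - Λ z)]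
        · rw [indicator_of_notMem hzN, zero_add]
          have hle : a₀ z ≤ N' := not_lt.1 hzN
          calc a₀ z * |exp (-(Λk k z)) - exp (-(Λ z))| ≤ N' * |exp (-(Λk k z)) - exp (-(Λ z))| :=
                mul_le_mul_of_nonneg_right hle (abs_nonneg _)
            _ ≤ N' * |Λk k z - Λ z| := mul_le_mul_of_nonneg_left (hDle k z) hN'0.le
      · rw [indicator_of_mem (mem_compl hzR), indicator_of_notMem hzR, mul_zero, add_zero]
        have h2 : 0 ≤ SN.indicator a₀ z := indicator_nonneg (fun z _ => ha₀0 z) z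
        linarith
    -- integrability of the three majorants
    have hi1 : Integrable (SRᶜ.indicator a₀) μ := ha₀i.indicator hSRm.compl
    have hi2 : Integrable (SN.indicator a₀) μ := ha₀i.indicator hSNm
    have hΔint : IntegrableOn (fun z => |Λk k z - Λ z|) SR μ := by
      have hfin : ∫⁻ z in SR, ‖Λk k z - Λ z‖ₑ ∂μ < ∞ := lt_of_le_of_lt (hK₀ k hk) ENNReal.ofReal_lt_top
      refine ⟨((hΛkm k).sub hΛm).abs.aestronglyMeasurable, ?_⟩
      rw [hasFiniteIntegral_iff_enorm]
      refine lt_of_le_of_lt (lintegral_mono fun z => ?_) hfin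
      rw [Real.enorm_eq_ofReal_abs, abs_abs, ← Real.enorm_eq_ofReal_abs]
    have hi3 : Integrable (fun z => N' * SR.indicator (fun z => |Λk k z - Λ z|) z) μ :=
      (hΔint.integrable_indicator hSRm).const_mul N'
    have hΔeq : ∫ z in SR, |Λk k z - Λ z| ∂μ = (∫⁻ z in SR, ‖Λk k z - Λ z‖ₑ ∂μ).toReal := by
      rw [integral_eq_lintegral_of_nonneg_ae (f := fun z => |Λk k z - Λ z|) (ae_of_all _ fun z => abs_nonneg _)
        ((hΛkm k).sub hΛm).abs.aestronglyMeasurable]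
      congr 1
      refine lintegral_congr fun z => ?_
      rw [← Real.enorm_eq_ofReal_abs]
    have hΔle : ∫ z in SR, |Λk k z - Λ z| ∂μ ≤ ε / (4 * N') := by
      rw [hΔeq]
      exact ENNReal.toReal_le_of_le_ofReal (by positivity) (hK₀ k hk)
    calc ∫ z, a₀ z * |exp (-(Λk k z)) - exp (-(Λ z))| ∂μ
        ≤ ∫ z, (SRᶜ.indicator a₀ z + SN.indicator a₀ z + N' * SR.indicator (fun z => |Λk k z - Λ z|) z) ∂μ :=
          integral_mono_of_nonneg (ae_of_all _ fun z => mul_nonneg (ha₀0 z) (abs_nonneg _))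
            ((hi1.add hi2).add hi3) (ae_of_all _ hpt)
      _ = (∫ z in SRᶜ, a₀ z ∂μ) + (∫ z in SN, a₀ z ∂μ) + N' * ∫ z in SR, |Λk k z - Λ z| ∂μ := by
          rw [integral_add (f := fun z => SRᶜ.indicator a₀ z + SN.indicator a₀ z)
            (g := fun z => N' * SR.indicator (fun z => |Λk k z - Λ z|) z) (hi1.add hi2) hi3,
            integral_add (f := SRᶜ.indicator a₀) (g := SN.indicator a₀) hi1 hi2, integral_indicator hSRm.compl,
            integral_indicator hSNm, integral_const_mul, integral_indicator hSRm]
      _ ≤ ε / 4 + ε / 4 + N' * (ε / (4 * N')) := by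
          gcongr
      _ < ε := by
          have : N' * (ε / (4 * N')) = ε / 4 := by field_simp
          rw [this]; linarith

/-- **The damping weights converge along the characteristics** (CIP 1994 §5.3 Step 13, (3.35):
the weak continuity of `T_{Fₙ}⁻¹`, here through `Fₙ → F` in `L¹`): for `t ∈ [0,T]` and every `R`,
`∫_{E×B̄_R} ∫₀ᵗ |e^{-(Λₖ♯(t)-Λₖ♯(s))} - (1 ∧ e^{-(F♯(t)-F♯(s))})| ds → 0`, since the integrand is at
most `|Λₖ♯(t) - F♯(t)| + |Λₖ♯(s) - F♯(s)|` and `sup_{s ≤ T} ‖Λₖ♯(s) - F♯(s)‖_{L¹(E×B̄_R)} ≤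
‖λₖ - A∗f‖_{L¹((0,T)×E×B̄_R)} → 0` (`DiPernaLionsDampingLimit`, `DiPernaLionsFrequencyLimit`). [cite: CIPDiluteGases1994, §5.3 Step 13 (3.35) (p. 157)] -/
theorem IsDiPernaLionsWeakLimit.tendsto_lintegral_dampingWeight_sub
    (hW : IsDiPernaLionsWeakLimit f₀ fseq φ f) (h9 : velocityAverage_relativelyCompact_L1.{u})
    (hB : IsDiPernaLionsKernel B) (hf₀ : HasDiPernaLionsData f₀) (hδ : ∀ n, 0 < δ n)
    (hanti : Antitone δ) (hlim : Tendsto δ atTop (𝓝 0)) (hker : IsDiPernaLionsKernelApproximation B Bseq)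
    (hdata : IsDiPernaLionsDataApproximation f₀ (fun n => fseq n 0))
    (hsol : ∀ n, IsDiPernaLionsApproximateSolution (δ n) (Bseq n) (fseq n))
    (hbd : UniformDiPernaLionsBounds δ Bseq fseq) {T t : ℝ} (ht : t ∈ Icc 0 T) (R : ℝ) :
    Tendsto (fun k => ∫⁻ z in univ ×ˢ closedBall (0 : E) R, (∫⁻ s in Ioc 0 t,
        ‖exp (-(truncatedDampingExponent (δ (φ k)) (Bseq (φ k)) (fseq (φ k)) t z.1 z.2 -
              truncatedDampingExponent (δ (φ k)) (Bseq (φ k)) (fseq (φ k)) s z.1 z.2)) -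
          min 1 (exp (-(dampingExponent B f t z.1 z.2 - dampingExponent B f s z.1 z.2)))‖ₑ)
        ∂((volume : Measure E).prod volume)) atTop (𝓝 0) := by
  set μ : Measure (E × E) := ((volume : Measure E).prod volume).restrict (univ ×ˢ closedBall (0 : E) R)
    with hμ
  set Λk : ℕ → ℝ → E × E → ℝ := fun k τ z =>
    truncatedDampingExponent (δ (φ k)) (Bseq (φ k)) (fseq (φ k)) τ z.1 z.2 with hΛk
  set Λ : ℝ → E × E → ℝ := fun τ z => dampingExponent B f τ z.1 z.2 with hΛ
  set Dk : ℕ → ℝ≥0∞ := fun k => ∫⁻ q in Ioo 0 T ×ˢ (univ ×ˢ closedBall (0 : E) R),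
    ‖truncatedCollisionFrequency (δ (φ k)) (Bseq (φ k)) (fseq (φ k)) q.1 q.2.1 q.2.2 -
      DiPernaLionsMildLimit.collisionFrequency B f q.1 q.2.1 q.2.2‖ₑ with hDk
  have ht0 : 0 ≤ t := ht.1
  -- measurability
  have hΛkm : ∀ k, Measurable fun p : ℝ × (E × E) => Λk k p.1 p.2 := fun k =>
    (hsol (φ k)).measurable_truncatedDampingExponent (hker.isDiPernaLionsKernel (φ k)).measurable
  have hΛm : Measurable fun p : ℝ × (E × E) => Λ p.1 p.2 := measurable_dampingExponent hB.measurable hW.measurable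
  have hΔm : ∀ k, Measurable fun p : ℝ × (E × E) => ‖Λk k p.1 p.2 - Λ p.1 p.2‖ₑ := fun k =>
    ((hΛkm k).sub hΛm).enorm
  -- the uniform-in-time `L¹` bound
  have hslice : ∀ k, ∀ τ ∈ Icc 0 T, ∫⁻ z, ‖Λk k τ z - Λ τ z‖ₑ ∂μ ≤ Dk k := fun k τ hτ =>
    lintegral_enorm_truncatedDampingExponent_sub_le hB hf₀ hδ hanti hlim hker hdata hsol hbd hW hτ R (φ k)
  -- pointwise bound
  have hpt : ∀ k z, ∀ s ∈ Ioc 0 t,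
      ‖exp (-(Λk k t z - Λk k s z)) - min 1 (exp (-(Λ t z - Λ s z)))‖ₑ ≤
        ‖Λk k t z - Λ t z‖ₑ + ‖Λk k s z - Λ s z‖ₑ := by
    intro k z s hs
    obtain ⟨Cb, hCb⟩ := hker.bounded (φ k)
    have hBk := hker.isDiPernaLionsKernel (φ k)
    have hmono : Λk k s z ≤ Λk k t z :=
      (hsol (φ k)).truncatedDampingExponent_mono hBk.measurable hBk.nonneg hCb (hδ (φ k)).le z.1 z.2
        hs.1.le hs.2
    have h1 := abs_exp_neg_sub_min_le (y := Λ t z - Λ s z) (sub_nonneg.2 hmono)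
    rw [Real.enorm_eq_ofReal_abs, Real.enorm_eq_ofReal_abs, Real.enorm_eq_ofReal_abs,
      ← ENNReal.ofReal_add (abs_nonneg _) (abs_nonneg _)]
    refine ENNReal.ofReal_le_ofReal (h1.trans ?_)
    have : Λk k t z - Λk k s z - (Λ t z - Λ s z) = (Λk k t z - Λ t z) - (Λk k s z - Λ s z) := by ring
    rw [this]
    exact abs_sub _ _
  -- integrate
  have hbound : ∀ k, ∫⁻ z, (∫⁻ s in Ioc 0 t, ‖exp (-(Λk k t z - Λk k s z)) -
      min 1 (exp (-(Λ t z - Λ s z)))‖ₑ) ∂μ ≤ 2 * (ENNReal.ofReal t * Dk k) := by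
    intro k
    calc ∫⁻ z, (∫⁻ s in Ioc 0 t, ‖exp (-(Λk k t z - Λk k s z)) - min 1 (exp (-(Λ t z - Λ s z)))‖ₑ) ∂μ
        ≤ ∫⁻ z, (∫⁻ s in Ioc 0 t, (‖Λk k t z - Λ t z‖ₑ + ‖Λk k s z - Λ s z‖ₑ)) ∂μ :=
          lintegral_mono fun z => setLIntegral_mono' measurableSet_Ioc fun s hs => hpt k z s hs
      _ = ∫⁻ z, (ENNReal.ofReal t * ‖Λk k t z - Λ t z‖ₑ + ∫⁻ s in Ioc 0 t, ‖Λk k s z - Λ s z‖ₑ) ∂μ := by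
          refine lintegral_congr fun z => ?_
          rw [lintegral_add_left measurable_const, setLIntegral_const, Real.volume_Ioc, sub_zero, mul_comm]
      _ = ENNReal.ofReal t * ∫⁻ z, ‖Λk k t z - Λ t z‖ₑ ∂μ +
            ∫⁻ z, (∫⁻ s in Ioc 0 t, ‖Λk k s z - Λ s z‖ₑ) ∂μ := by
          have hm0 : Measurable fun z : E × E => ‖Λk k t z - Λ t z‖ₑ :=
            (hΔm k).comp (measurable_const.prodMk measurable_id)
          have hm1 : Measurable fun z : E × E => ENNReal.ofReal t * ‖Λk k t z - Λ t z‖ₑ := hm0.const_mul _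
          rw [lintegral_add_left hm1, lintegral_const_mul _ hm0]
      _ ≤ ENNReal.ofReal t * Dk k + ENNReal.ofReal t * Dk k := by
          refine add_le_add (mul_le_mul_right (hslice k t ht) _) ?_
          -- Tonelli: swap `z` and `s`
          have hsw : AEMeasurable (Function.uncurry fun (z : E × E) (s : ℝ) => ‖Λk k s z - Λ s z‖ₑ)
              (μ.prod ((volume : Measure ℝ).restrict (Ioc 0 t))) :=
            ((hΔm k).comp measurable_swap).aemeasurable
          rw [lintegral_lintegral_swap hsw]
          calc ∫⁻ s in Ioc 0 t, ∫⁻ z, ‖Λk k s z - Λ s z‖ₑ ∂μ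
              ≤ ∫⁻ s in Ioc 0 t, Dk k := setLIntegral_mono' measurableSet_Ioc fun s hs =>
                  hslice k s ⟨hs.1.le, hs.2.trans ht.2⟩
            _ = ENNReal.ofReal t * Dk k := by
                rw [setLIntegral_const, Real.volume_Ioc, sub_zero, mul_comm]
      _ = 2 * (ENNReal.ofReal t * Dk k) := by ring
  -- the right-hand side tends to zero
  have hD : Tendsto Dk atTop (𝓝 0) :=
    tendsto_lintegral_box_normalisedFrequency_sub h9 hB hf₀ hδ hanti hlim hker hdata hsol hbd hW T R
  have h0 : Tendsto (fun k => 2 * (ENNReal.ofReal t * Dk k)) atTop (𝓝 0) := by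
    have h1 : Tendsto (fun k => ENNReal.ofReal t * Dk k) atTop (𝓝 (ENNReal.ofReal t * 0)) :=
      ENNReal.Tendsto.const_mul hD (Or.inr ENNReal.ofReal_ne_top)
    rw [mul_zero] at h1
    have h2 : Tendsto (fun k => 2 * (ENNReal.ofReal t * Dk k)) atTop (𝓝 (2 * 0)) :=
      ENNReal.Tendsto.const_mul h1 (Or.inr ENNReal.ofNat_ne_top)
    rwa [mul_zero] at h2
  exact tendsto_of_tendsto_of_tendsto_of_le_of_le tendsto_const_nhds h0 (fun k => zero_le) hbound


end Limits

end Literature.MathematicalPhysics.KineticTheory
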